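import Literature.NumberTheory.EllipticCurves.ZpExtensionEisensteinDVRSetting
import HarnessLib

/-!
# The Eisenstein `DVRSetting` of the curve: the bookkeeping fields of `SatisfiesH` (proofs file)

Topic `NumberTheory/EllipticCurves` (D1 road of cell `pub/bsd-print-x9`; companion of
`ZpExtensionEisensteinDVRSetting`, whose `WeierstrassCurve.eisensteinDVRSetting` is the curve's Eisenstein
specialisation `(T_𝔮, F_𝔮, 𝓛)` as a term of `Howard2004.DVRSetting`).  THEOREMS ONLY; no definition, no named fact,
no instance, no notation, no `sorry`.

Howard's Thm. 1.6.1 (cite-only `Howard2004.thm161_dvrKolyvaginBound`) is stated under `DVRSetting.SatisfiesH` (H.0–H.5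
plus the typing clauses T1–T7 of the part-B file).  For the Eisenstein setting the following clauses are FREE — they
follow from the construction and the tree's facts about `S_m = Λ/(T^m + p)` and its tower — and are recorded here as
named theorems (one per field, same names with the prefix `eisensteinDVRSetting_`):
`coeffRing` (`isCoefficientRing_quotient_X_pow_add_C`), `unif` (`maximalIdeal_quotient_X_pow_add_C_eq`),
`e_strictMono`, `e_zero`, `killed` (`maximalIdeal_pow_mul_smul_eisensteinLevel`), `ker_red` (`ker_eisensteinLevelRed`
with `torsionGaloisModuleReduce_surjective/_eq_zero_iff`: the tower is EXACT), `algebraMap_surjective`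
(`ofSpec_surjective`), `ker_algebraMap` (`ker_ofSpec`), `redR_comp`, `scalarLinear`, `L_subset`, `L_disjoint`, `θ_eq` (`Sigma_eq` and
`primes_eq` are `eisensteinDVRSetting_t_Sigma` / `eisensteinDVRSetting_t_primes` of the companion file), and **`fsQ_spec`** through the bridge `eisensteinDVRSetting_rqLocH1_apply`
(`rqLocH1 = galoisCohomology.map (eisensteinLevelQuotRedLoc …) 1`, definitional).  The first clause of H.1 is
`isQuotientBy_eisensteinDVRSetting_πbar` of the companion file.  What remains of `SatisfiesH` for the v9 stubs:
`p_odd`, `imagQuad` (frame hypotheses), `h0`–`h5c`, `cond_smul`, `cond_red`, `πbar_red`, `e_red`, `fs_natural`,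
`fs_admissible`.  Every statement carries the CONSUMER PREAMBLE of the companion file.  BSD is not proved by any of this.

References: [Howard2004HeegnerKolyvagin] §1 conventions (arXiv:1202.6340 p. 4 L47–52), §1.6 (p. 11 L13–38, p. 12
L29–55), Def. 1.2.3, §2.2; [Washington1997] §13.2; [SerreGaloisCohomology1997] I §2.2.
-/

set_option autoImplicit false

noncomputable section

open Function NumberField IsDedekindDomain Field
open scoped NumberField ContRepresentation TensorProduct Classical

/-! ## Bookkeeping: the FREE fields of `SatisfiesH` for the Eisenstein setting (everything except H.0–H.5 proper,
`cond_smul`/`cond_red`, `e_red`, `h5*` and the `fs` clauses), as named theorems -/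

namespace WeierstrassCurve

open Literature.NumberTheory.EllipticCurves Literature.NumberTheory.GaloisRepresentations
open Literature.NumberTheory.GaloisRepresentations.DiscreteGaloisModule
open Literature.NumberTheory.GaloisCohomology.Howard2004
open Literature.NumberTheory.EllipticCurves.ZpExtension (EisensteinLevel)

variable {K : Type} [Field K] [NumberField K] (W : WeierstrassCurve ℚ) [W.IsElliptic] {p : ℕ} [hp : Fact p.Prime]
  (κ : ZpExtension K p) {m : ℕ} (hm : 1 ≤ m)
  (S : Finset (HeightOneSpectrum (𝓞 K)))
  (hpS : ∀ v : HeightOneSpectrum (𝓞 K), ((p : ℕ) : 𝓞 K) ∈ v.asIdeal → v ∈ S)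
  (hbad : ∀ v : HeightOneSpectrum (𝓞 K), v ∉ S → ((p : ℕ) : 𝓞 K) ∉ v.asIdeal → (W.baseChange K).HasGoodReductionAt v)
  (L : Set (HeightOneSpectrum (𝓞 K)))
  (hL : letI := IwasawaAlgebra.isLocalRing_quotient_X_pow_add_C p hm
    L ⊆ (W.eisensteinTower κ hm).degreeTwoPrimes p)
  (hLS : ∀ v ∈ L, v ∉ S)
  (jbar : AlgebraicClosure K →+* ℂ) (cd : ConjugationDatum K)
  (D : letI := IwasawaAlgebra.isLocalRing_quotient_X_pow_add_C p hm
    ∀ k, DualityDatum p cd ((W.eisensteinTower κ hm).ρ k) (IwasawaAlgebra.EisensteinCoeff p m (k + 1)))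
  (fs : letI := IwasawaAlgebra.isLocalRing_quotient_X_pow_add_C p hm
    ∀ (k : ℕ) (n : Finset (HeightOneSpectrum (𝓞 K))) (v : HeightOneSpectrum (𝓞 K)),
      galoisCohomology ((W.eisensteinLevelQuot κ hm k n).toLocal (Sum.inr v)) 1 →+
        SingularQuotient (GaloisRep.toLocal v (W.eisensteinLevelQuot κ hm k n)) ⊗[ℤ] Gell v)

set_option synthInstance.maxHeartbeats 80000 in
/-- `SatisfiesH.coeffRing`: `S_m` is a coefficient ring (`isCoefficientRing_quotient_X_pow_add_C`).
[cite: Howard2004HeegnerKolyvagin, §1 conventions (arXiv p. 4, L47–52)] -/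
theorem eisensteinDVRSetting_coeffRing :
    letI := IwasawaAlgebra.isDomain_quotient_X_pow_add_C p hm
    letI := IwasawaAlgebra.isDiscreteValuationRing_quotient_X_pow_add_C p hm
    haveI := IwasawaAlgebra.EisensteinCoeff.isLocalRing_succ p hm
    letI := IwasawaAlgebra.EisensteinCoeff.algebraOfSpecSucc p m
    haveI := W.isScalarTower_algebraOfSpecSucc (K := K) (p := p) (m := m)
    letI := W.residueModuleSucc (K := K) (p := p) hm
    IsCoefficientRing p (IwasawaAlgebra p ⧸
      Ideal.span {(PowerSeries.X ^ m + PowerSeries.C (p : ℤ_[p]) : IwasawaAlgebra p)}) :=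
  IwasawaAlgebra.isCoefficientRing_quotient_X_pow_add_C p hm

set_option synthInstance.maxHeartbeats 80000 in
/-- `SatisfiesH.unif`: `𝔪_{S_m} = (π)`, `π = T mod q_m` (`maximalIdeal_quotient_X_pow_add_C_eq`).
[cite: Howard2004HeegnerKolyvagin, §1.6 (arXiv p. 11, L13–14) and §2.2] -/
theorem eisensteinDVRSetting_unif :
    letI := IwasawaAlgebra.isDomain_quotient_X_pow_add_C p hm
    letI := IwasawaAlgebra.isDiscreteValuationRing_quotient_X_pow_add_C p hm
    haveI := IwasawaAlgebra.EisensteinCoeff.isLocalRing_succ p hm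
    letI := IwasawaAlgebra.EisensteinCoeff.algebraOfSpecSucc p m
    haveI := W.isScalarTower_algebraOfSpecSucc (K := K) (p := p) (m := m)
    letI := W.residueModuleSucc (K := K) (p := p) hm
    IsLocalRing.maximalIdeal (IwasawaAlgebra p ⧸
        Ideal.span {(PowerSeries.X ^ m + PowerSeries.C (p : ℤ_[p]) : IwasawaAlgebra p)}) =
      Ideal.span {(W.eisensteinDVRSetting κ hm S hpS hbad L hL hLS jbar cd D fs).π} :=
  IwasawaAlgebra.maximalIdeal_quotient_X_pow_add_C_eq p hm

set_option synthInstance.maxHeartbeats 80000 in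
/-- `SatisfiesH.e_strictMono`: `k ↦ m(k+1)` is strictly increasing (`m ≥ 1`). [cite: Howard2004HeegnerKolyvagin, §1.6 (arXiv p. 11, L18–20)] -/
theorem eisensteinDVRSetting_e_strictMono :
    letI := IwasawaAlgebra.isDomain_quotient_X_pow_add_C p hm
    letI := IwasawaAlgebra.isDiscreteValuationRing_quotient_X_pow_add_C p hm
    haveI := IwasawaAlgebra.EisensteinCoeff.isLocalRing_succ p hm
    letI := IwasawaAlgebra.EisensteinCoeff.algebraOfSpecSucc p m
    haveI := W.isScalarTower_algebraOfSpecSucc (K := K) (p := p) (m := m)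
    letI := W.residueModuleSucc (K := K) (p := p) hm
    StrictMono (W.eisensteinDVRSetting κ hm S hpS hbad L hL hLS jbar cd D fs).e :=
  fun a b hab ↦ (Nat.mul_lt_mul_left (by omega)).mpr (by omega)

set_option synthInstance.maxHeartbeats 80000 in
/-- `SatisfiesH.e_zero`: `e_0 = m > 0`. [cite: Howard2004HeegnerKolyvagin, §1.6 (arXiv p. 11, L18–20)] -/
theorem eisensteinDVRSetting_e_zero :
    letI := IwasawaAlgebra.isDomain_quotient_X_pow_add_C p hm
    letI := IwasawaAlgebra.isDiscreteValuationRing_quotient_X_pow_add_C p hm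
    haveI := IwasawaAlgebra.EisensteinCoeff.isLocalRing_succ p hm
    letI := IwasawaAlgebra.EisensteinCoeff.algebraOfSpecSucc p m
    haveI := W.isScalarTower_algebraOfSpecSucc (K := K) (p := p) (m := m)
    letI := W.residueModuleSucc (K := K) (p := p) hm
    0 < (W.eisensteinDVRSetting κ hm S hpS hbad L hL hLS jbar cd D fs).e 0 := by
  change 0 < m * (0 + 1)
  omega

set_option synthInstance.maxHeartbeats 80000 in
/-- `SatisfiesH.killed`: `𝔪^{m(k+1)}` kills `T^{(k)}` (`maximalIdeal_pow_mul_smul_eisensteinLevel`).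
[cite: Howard2004HeegnerKolyvagin, §1.6 (arXiv p. 12: T/𝔪^{e_k}) and proof of Thm. 2.2.10] -/
theorem eisensteinDVRSetting_killed (k : ℕ) :
    letI := IwasawaAlgebra.isDomain_quotient_X_pow_add_C p hm
    letI := IwasawaAlgebra.isDiscreteValuationRing_quotient_X_pow_add_C p hm
    haveI := IwasawaAlgebra.EisensteinCoeff.isLocalRing_succ p hm
    letI := IwasawaAlgebra.EisensteinCoeff.algebraOfSpecSucc p m
    haveI := W.isScalarTower_algebraOfSpecSucc (K := K) (p := p) (m := m)
    letI := W.residueModuleSucc (K := K) (p := p) hm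
    ∀ r ∈ IsLocalRing.maximalIdeal (IwasawaAlgebra p ⧸
        Ideal.span {(PowerSeries.X ^ m + PowerSeries.C (p : ℤ_[p]) : IwasawaAlgebra p)}) ^ (W.eisensteinDVRSetting κ hm S hpS hbad L hL hLS jbar cd D fs).e k,
      ∀ x : EisensteinLevel p m (fun j ↦ geomTorsion (W.baseChange K) ((p : ℤ) ^ j)) (k + 1), r • x = 0 :=
  fun r hr x ↦ ZpExtension.maximalIdeal_pow_mul_smul_eisensteinLevel hm (k + 1) r hr x

set_option synthInstance.maxHeartbeats 80000 in
/-- `SatisfiesH.ker_red`: the tower is EXACT — `ker(T^{(k+1)} ↠ T^{(k)}) = 𝔪^{m(k+1)} T^{(k+1)}` (`ker_eisensteinLevelRed`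
with the `E`-inputs `torsionGaloisModuleReduce_surjective/_eq_zero_iff`).
[cite: Howard2004HeegnerKolyvagin, §1.6 (arXiv p. 12: the exact tower) and proof of Thm. 2.2.10] -/
theorem eisensteinDVRSetting_ker_red (k : ℕ) :
    letI := IwasawaAlgebra.isDomain_quotient_X_pow_add_C p hm
    letI := IwasawaAlgebra.isDiscreteValuationRing_quotient_X_pow_add_C p hm
    haveI := IwasawaAlgebra.EisensteinCoeff.isLocalRing_succ p hm
    letI := IwasawaAlgebra.EisensteinCoeff.algebraOfSpecSucc p m
    haveI := W.isScalarTower_algebraOfSpecSucc (K := K) (p := p) (m := m)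
    letI := W.residueModuleSucc (K := K) (p := p) hm
    LinearMap.ker ((W.eisensteinDVRSetting κ hm S hpS hbad L hL hLS jbar cd D fs).T.red k) =
      (IsLocalRing.maximalIdeal (IwasawaAlgebra p ⧸
          Ideal.span {(PowerSeries.X ^ m + PowerSeries.C (p : ℤ_[p]) : IwasawaAlgebra p)}) ^ (W.eisensteinDVRSetting κ hm S hpS hbad L hL hLS jbar cd D fs).e k) •
        (⊤ : Submodule (IwasawaAlgebra p ⧸
          Ideal.span {(PowerSeries.X ^ m + PowerSeries.C (p : ℤ_[p]) : IwasawaAlgebra p)})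
          (EisensteinLevel p m (fun j ↦ geomTorsion (W.baseChange K) ((p : ℤ) ^ j)) (k + 1 + 1))) :=
  κ.ker_eisensteinLevelRed (fun j ↦ (W.baseChange K).torsionGaloisModule ((p : ℤ) ^ j))
    (fun j ↦ (W.baseChange K).torsionGaloisModuleReduce p j) hm (k + 1)
    ((W.baseChange K).torsionGaloisModuleReduce_surjective p (k + 1))
    ((W.baseChange K).torsionGaloisModuleReduce_eq_zero_iff p (k + 1))

set_option synthInstance.maxHeartbeats 80000 in
/-- `SatisfiesH.algebraMap_surjective`: `S_m ↠ A_{m,k+1}` (`ofSpec_surjective`). [cite: Howard2004HeegnerKolyvagin, §1.6 (arXiv p. 11, L13–20)] -/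
theorem eisensteinDVRSetting_algebraMap_surjective (k : ℕ) :
    letI := IwasawaAlgebra.isDomain_quotient_X_pow_add_C p hm
    letI := IwasawaAlgebra.isDiscreteValuationRing_quotient_X_pow_add_C p hm
    haveI := IwasawaAlgebra.EisensteinCoeff.isLocalRing_succ p hm
    letI := IwasawaAlgebra.EisensteinCoeff.algebraOfSpecSucc p m
    haveI := W.isScalarTower_algebraOfSpecSucc (K := K) (p := p) (m := m)
    letI := W.residueModuleSucc (K := K) (p := p) hm
    Function.Surjective (algebraMap (IwasawaAlgebra p ⧸
        Ideal.span {(PowerSeries.X ^ m + PowerSeries.C (p : ℤ_[p]) : IwasawaAlgebra p)})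
      (IwasawaAlgebra.EisensteinCoeff p m (k + 1))) :=
  IwasawaAlgebra.EisensteinCoeff.ofSpec_surjective m (k + 1)

set_option synthInstance.maxHeartbeats 80000 in
/-- `SatisfiesH.ker_algebraMap`: `ker(S_m ↠ A_{m,k+1}) = 𝔪^{m(k+1)}` (`ker_ofSpec`). [cite: Howard2004HeegnerKolyvagin, §1.6 (arXiv p. 11, L13–20)] -/
theorem eisensteinDVRSetting_ker_algebraMap (k : ℕ) :
    letI := IwasawaAlgebra.isDomain_quotient_X_pow_add_C p hm
    letI := IwasawaAlgebra.isDiscreteValuationRing_quotient_X_pow_add_C p hm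
    haveI := IwasawaAlgebra.EisensteinCoeff.isLocalRing_succ p hm
    letI := IwasawaAlgebra.EisensteinCoeff.algebraOfSpecSucc p m
    haveI := W.isScalarTower_algebraOfSpecSucc (K := K) (p := p) (m := m)
    letI := W.residueModuleSucc (K := K) (p := p) hm
    RingHom.ker (algebraMap (IwasawaAlgebra p ⧸
        Ideal.span {(PowerSeries.X ^ m + PowerSeries.C (p : ℤ_[p]) : IwasawaAlgebra p)})
      (IwasawaAlgebra.EisensteinCoeff p m (k + 1))) =
      IsLocalRing.maximalIdeal (IwasawaAlgebra p ⧸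
        Ideal.span {(PowerSeries.X ^ m + PowerSeries.C (p : ℤ_[p]) : IwasawaAlgebra p)}) ^ (W.eisensteinDVRSetting κ hm S hpS hbad L hL hLS jbar cd D fs).e k :=
  IwasawaAlgebra.EisensteinCoeff.ker_ofSpec hm (k + 1)

set_option synthInstance.maxHeartbeats 80000 in
/-- `SatisfiesH.redR_comp`: the reductions of the level rings commute with the structure maps from `S_m`.
[cite: Howard2004HeegnerKolyvagin, §1.6 (arXiv p. 11, L13–20)] -/
theorem eisensteinDVRSetting_redR_comp (k : ℕ)
    (r : IwasawaAlgebra p ⧸ Ideal.span {(PowerSeries.X ^ m + PowerSeries.C (p : ℤ_[p]) : IwasawaAlgebra p)}) :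
    letI := IwasawaAlgebra.isDomain_quotient_X_pow_add_C p hm
    letI := IwasawaAlgebra.isDiscreteValuationRing_quotient_X_pow_add_C p hm
    haveI := IwasawaAlgebra.EisensteinCoeff.isLocalRing_succ p hm
    letI := IwasawaAlgebra.EisensteinCoeff.algebraOfSpecSucc p m
    haveI := W.isScalarTower_algebraOfSpecSucc (K := K) (p := p) (m := m)
    letI := W.residueModuleSucc (K := K) (p := p) hm
    (W.eisensteinDVRSetting κ hm S hpS hbad L hL hLS jbar cd D fs).redR k (algebraMap _ (IwasawaAlgebra.EisensteinCoeff p m (k + 1 + 1)) r) =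
      algebraMap _ (IwasawaAlgebra.EisensteinCoeff p m (k + 1)) r := by
  obtain ⟨f, rfl⟩ := Ideal.Quotient.mk_surjective r
  rfl

set_option synthInstance.maxHeartbeats 80000 in
/-- `SatisfiesH.scalarLinear`: `Γ_K` acts `A_{m,k+1}`-linearly on `T^{(k)}`. [cite: Howard2004HeegnerKolyvagin, §1.6 (arXiv p. 11, L33–38)] -/
theorem eisensteinDVRSetting_scalarLinear (k : ℕ) :
    letI := IwasawaAlgebra.isDomain_quotient_X_pow_add_C p hm
    letI := IwasawaAlgebra.isDiscreteValuationRing_quotient_X_pow_add_C p hm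
    haveI := IwasawaAlgebra.EisensteinCoeff.isLocalRing_succ p hm
    letI := IwasawaAlgebra.EisensteinCoeff.algebraOfSpecSucc p m
    haveI := W.isScalarTower_algebraOfSpecSucc (K := K) (p := p) (m := m)
    letI := W.residueModuleSucc (K := K) (p := p) hm
    ((W.eisensteinDVRSetting κ hm S hpS hbad L hL hLS jbar cd D fs).T.ρ k).IsScalarLinear (IwasawaAlgebra.EisensteinCoeff p m (k + 1)) :=
  κ.isScalarLinear_eisensteinAdicTowerSucc_coeff (fun j ↦ (W.baseChange K).torsionGaloisModule ((p : ℤ) ^ j))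
        (fun j ↦ (W.baseChange K).torsionGaloisModuleReduce p j) hm
        (fun j ↦ (W.baseChange K).torsionGaloisModuleReduce_surjective p j) k

set_option synthInstance.maxHeartbeats 80000 in
/-- `SatisfiesH.L_subset`: `𝓛 ⊆ 𝓛₀(T)` (the caller's `hL`). [cite: Howard2004HeegnerKolyvagin, §1.2 (arXiv p. 6, L97–99)] -/
theorem eisensteinDVRSetting_L_subset :
    letI := IwasawaAlgebra.isDomain_quotient_X_pow_add_C p hm
    letI := IwasawaAlgebra.isDiscreteValuationRing_quotient_X_pow_add_C p hm
    haveI := IwasawaAlgebra.EisensteinCoeff.isLocalRing_succ p hm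
    letI := IwasawaAlgebra.EisensteinCoeff.algebraOfSpecSucc p m
    haveI := W.isScalarTower_algebraOfSpecSucc (K := K) (p := p) (m := m)
    letI := W.residueModuleSucc (K := K) (p := p) hm
    (W.eisensteinDVRSetting κ hm S hpS hbad L hL hLS jbar cd D fs).L ⊆ (W.eisensteinDVRSetting κ hm S hpS hbad L hL hLS jbar cd D fs).T.degreeTwoPrimes p :=
  hL

set_option synthInstance.maxHeartbeats 80000 in
/-- `SatisfiesH.L_disjoint`: `𝓛 ∩ Σ(F) = ∅` (the caller's `hLS`). [cite: Howard2004HeegnerKolyvagin, §1.2 (arXiv p. 6, L97–99)] -/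
theorem eisensteinDVRSetting_L_disjoint :
    letI := IwasawaAlgebra.isDomain_quotient_X_pow_add_C p hm
    letI := IwasawaAlgebra.isDiscreteValuationRing_quotient_X_pow_add_C p hm
    haveI := IwasawaAlgebra.EisensteinCoeff.isLocalRing_succ p hm
    letI := IwasawaAlgebra.EisensteinCoeff.algebraOfSpecSucc p m
    haveI := W.isScalarTower_algebraOfSpecSucc (K := K) (p := p) (m := m)
    letI := W.residueModuleSucc (K := K) (p := p) hm
    ∀ v ∈ (W.eisensteinDVRSetting κ hm S hpS hbad L hL hLS jbar cd D fs).L, (Sum.inr v : Place K) ∉ (W.eisensteinDVRSetting κ hm S hpS hbad L hL hLS jbar cd D fs).Sigma :=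
  fun v hv h ↦ hLS v hv (Finset.inr_mem_disjSum.1 h)

set_option synthInstance.maxHeartbeats 80000 in
/-- `SatisfiesH.θ_eq`: ONE `θ = τ_*` on `E_K[p]` at all levels. [cite: Howard2004HeegnerKolyvagin, §1.3 H.5(a) (arXiv p. 7, L93–95)] -/
theorem eisensteinDVRSetting_θ_eq (k : ℕ) (x : geomTorsion (W.baseChange K) (p : ℤ)) :
    letI := IwasawaAlgebra.isDomain_quotient_X_pow_add_C p hm
    letI := IwasawaAlgebra.isDiscreteValuationRing_quotient_X_pow_add_C p hm
    haveI := IwasawaAlgebra.EisensteinCoeff.isLocalRing_succ p hm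
    letI := IwasawaAlgebra.EisensteinCoeff.algebraOfSpecSucc p m
    haveI := W.isScalarTower_algebraOfSpecSucc (K := K) (p := p) (m := m)
    letI := W.residueModuleSucc (K := K) (p := p) hm
    ((W.eisensteinDVRSetting κ hm S hpS hbad L hL hLS jbar cd D fs).A (k + 1)).θ x = ((W.eisensteinDVRSetting κ hm S hpS hbad L hL hLS jbar cd D fs).A k).θ x :=
  rfl

set_option synthInstance.maxHeartbeats 80000 in
/-- **`H¹` of the reduction of the Kolyvagin quotients at a place, in both spellings**: lit's `rqLocH1`
(`ContinuousRep.cohomologyMap` of `rq`) IS `galoisCohomology.map (eisensteinLevelQuotRedLoc …) 1` (same underlying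
continuous crossed homomorphisms). [cite: Howard2004HeegnerKolyvagin, §1.6 (arXiv p. 11, L49–50)] [cite: SerreGaloisCohomology1997, I §2.2] -/
theorem eisensteinDVRSetting_rqLocH1_apply (k : ℕ) (n : Finset (HeightOneSpectrum (𝓞 K))) (v : HeightOneSpectrum (𝓞 K))
    (x : letI := IwasawaAlgebra.isLocalRing_quotient_X_pow_add_C p hm
      galoisCohomology (GaloisRep.toLocal v (W.eisensteinLevelQuot κ hm (k + 1) n)) 1) :
    letI := IwasawaAlgebra.isDomain_quotient_X_pow_add_C p hm
    letI := IwasawaAlgebra.isDiscreteValuationRing_quotient_X_pow_add_C p hm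
    haveI := IwasawaAlgebra.EisensteinCoeff.isLocalRing_succ p hm
    letI := IwasawaAlgebra.EisensteinCoeff.algebraOfSpecSucc p m
    haveI := W.isScalarTower_algebraOfSpecSucc (K := K) (p := p) (m := m)
    letI := W.residueModuleSucc (K := K) (p := p) hm
    (W.eisensteinDVRSetting κ hm S hpS hbad L hL hLS jbar cd D fs).rqLocH1 k n v x =
      galoisCohomology.map (κ.eisensteinLevelQuotRedLoc (fun j ↦ (W.baseChange K).torsionGaloisModule ((p : ℤ) ^ j))
        (fun j ↦ (W.baseChange K).torsionGaloisModuleReduce p j) hm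
        (fun j ↦ (W.baseChange K).torsionGaloisModuleReduce_surjective p j)
        (fun j ↦ (W.baseChange K).torsionGaloisModuleReduce_eq_zero_iff p j) k n v) 1 x := by
  rfl

set_option synthInstance.maxHeartbeats 80000 in
/-- `SatisfiesH.fsQ_spec`: `fsQ` IS the map induced on singular quotients by `H¹` of the reduction at `v`.
[cite: Howard2004HeegnerKolyvagin, Def. 1.2.3 display (ks relations) (arXiv p. 6, L126–140)] -/
theorem eisensteinDVRSetting_fsQ_spec (k : ℕ) (n : Finset (HeightOneSpectrum (𝓞 K))) (v : HeightOneSpectrum (𝓞 K))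
    (x : letI := IwasawaAlgebra.isLocalRing_quotient_X_pow_add_C p hm
      galoisCohomology (GaloisRep.toLocal v (W.eisensteinLevelQuot κ hm (k + 1) n)) 1) :
    letI := IwasawaAlgebra.isDomain_quotient_X_pow_add_C p hm
    letI := IwasawaAlgebra.isDiscreteValuationRing_quotient_X_pow_add_C p hm
    haveI := IwasawaAlgebra.EisensteinCoeff.isLocalRing_succ p hm
    letI := IwasawaAlgebra.EisensteinCoeff.algebraOfSpecSucc p m
    haveI := W.isScalarTower_algebraOfSpecSucc (K := K) (p := p) (m := m)
    letI := W.residueModuleSucc (K := K) (p := p) hm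
    (W.eisensteinDVRSetting κ hm S hpS hbad L hL hLS jbar cd D fs).fsQ k n v (singularMap _ x) = singularMap _ ((W.eisensteinDVRSetting κ hm S hpS hbad L hL hLS jbar cd D fs).rqLocH1 k n v x) := by
  rfl

end WeierstrassCurve

end
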